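import Summits.QuantumFields.YangMills.Theorems.ColdStartUniversalityLatticeLangevinGradientBoundCurvature
import Summits.QuantumFields.YangMills.Theorems.ColdStartUniversalityLatticeLangevinWeightedFrameBochner
import HarnessLib

/-!
# Route `ColdStartUniversality` (fixed-cut-off package, Bakry–Émery side, WEIGHTED gradient bounds): the POINTWISE WEIGHTED
# curvature inequality `𝓛Γ^c(u) − 2Γ^c(u, 𝓛u) ≥ (2 − K₀)·Γ^c(u)` on `SU(2)^E`, `Γ^c(u) = Σ_n c_(e(n)) (W_n u)²`

Helper file (seat `ym-line-csu-p1`, g43; `--supports stmt-QuantumFields-24809`).  Weighted twin of g29's `…GradientBoundCurvature`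
for the SU(2) lattice Langevin (SZZ) dynamics at a fixed cut-off: a weight `c : Edge 3 L → ℝ`, `c ≥ 0`, one number per LINK, and the
WEIGHTED carré du champ along the noise frame `Γ^c(u)(V) = Σ_n c_(n.1) (W_n u)²(coords V)` (`n = (e, ν)`, `W_n u = Du[σ_n]`).
* `noiseField_comp_eq_zero_of_ne` — noise fields on different links compose to zero (`σ_m(σ_n y) = 0` for `n.1 ≠ m.1`), hence
  `weight_smul_noiseField_bracket_eq_zero`: every link weight is compatible with the frame (hypothesis `hw` of `…WeightedFrameBochner`);
* ★ `weighted_ricci_identity` — `¼ Σ_(n,m) c_(m.1) Λ(σ_mσ_n y − σ_nσ_m y)² = 2 Σ_n c_(n.1) Λ(σ_n y)²` for every linear functional `Λ`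
  (the Ricci identity of `…NoiseFrame`, link by link: brackets live on one link);
* ★★ `generator_wcarre_sub_ge_of_whessBound` — THE POINTWISE WEIGHTED `CD(1 − K₀/2, ∞)` INEQUALITY: if the frame Hessian of the
  plaquette function obeys the WEIGHTED bound `Σ_(n,m) c_(n.1) Λ(σ_n)Λ(σ_m)·W_nW_mψ̂ ≤ K₀ Σ_n c_(n.1) Λ(σ_n)²` (hypothesis `hHess`; for
  weights with ratio ≤ `b²` across the links of a plaquette it holds with `K₀ = (8 + 12b + 12/b)|β'|`, sequel file), then for `u ∈ C³` and
  any `C²` ambient representative `v` of `𝓛u` on the group,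
  `(2 − K₀)·Γ^c(u)(V) ≤ 𝓛(Σ_n c_(n.1)(W_nu)²)(V) − 2 Σ_n c_(n.1) W_nu·W_nv (coords V)` at EVERY configuration `V`
  (weighted pointwise Bochner `frameGammaTwo_pointwise_weighted` + weighted Ricci + `quarter_sum_sum_wsq_bracket_le` + `hHess`).
This is the infinitesimal form of the WEIGHTED gradient bound `Γ^c(P_t f) ≤ e^(−(2−K₀)t) P_t Γ^c f`, the analytic content of
Shen–Zhu–Zhu's weighted coupling estimate (CMP 400 (2023) Lemma 5.1, (5.13)).  THEOREMS ONLY, no definition, no sorry.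
HONEST FRAMING: fixed cut-off; pointwise calculus; nothing K-uniform; no crux, rung or summit statement is proved; the Yang–Mills
mass gap is NOT proved.
-/

set_option autoImplicit false

noncomputable section

namespace Summit.QuantumFields.YangMills.Theorems.ColdStartUniversality

open MeasureTheory Matrix Complex Finset
open scoped ComplexConjugate BigOperators Matrix
open Literature.MathematicalPhysics.QuantumFieldTheory
open Literature.MathematicalPhysics.QuantumLattice (fundamentalRep fundamentalLatticeRep continuous_fundamentalRep fundamentalRep_apply)

variable {L : ℕ} [NeZero L]

/-! ## §1. Noise fields on different links compose to zero; link weights are compatible with the frame -/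

omit [NeZero L] in
/-- Noise fields on DIFFERENT links compose to zero: `σ_m(σ_n y) = 0` whenever `n.1 ≠ m.1` (the field `σ_n` reads and writes only
the coordinates of its own link); stated for any family of linear maps `s` realising the noise fields (`hs`). [folklore] -/
theorem noiseField_comp_eq_zero_of_ne
    (s : (Edge 3 L × NoiseIdx (fundamentalLatticeRep 2).N) → ((Edge 3 L × Fin (fundamentalLatticeRep 2).N × Fin (fundamentalLatticeRep 2).N × Bool → ℝ) →L[ℝ] (Edge 3 L × Fin (fundamentalLatticeRep 2).N × Fin (fundamentalLatticeRep 2).N × Bool → ℝ)))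
    (hs : ∀ (n : Edge 3 L × NoiseIdx (fundamentalLatticeRep 2).N) (y : Edge 3 L × Fin (fundamentalLatticeRep 2).N × Fin (fundamentalLatticeRep 2).N × Bool → ℝ), s n y = (fun q : Edge 3 L × Fin (fundamentalLatticeRep 2).N × Fin (fundamentalLatticeRep 2).N × Bool => if n.1 = q.1 then (fun z : ℂ => if q.2.2.2 then z.im else z.re) (((Real.sqrt 2 : ℂ) • ((fundamentalLatticeRep 2).lieProj (noiseDir n.2) * (fun (ee : Edge 3 L) => Matrix.of fun (i j : Fin (fundamentalLatticeRep 2).N) => ((y (ee, i, j, false) : ℝ) : ℂ) + ((y (ee, i, j, true) : ℝ) : ℂ) * Complex.I) q.1)) q.2.1 q.2.2.1) else 0))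
    (n m : Edge 3 L × NoiseIdx (fundamentalLatticeRep 2).N) (hne : n.1 ≠ m.1) (y : Edge 3 L × Fin (fundamentalLatticeRep 2).N × Fin (fundamentalLatticeRep 2).N × Bool → ℝ) :
    s m (s n y) = 0 := by
  classical
  set P : NoiseIdx (fundamentalLatticeRep 2).N → Matrix (Fin (fundamentalLatticeRep 2).N) (Fin (fundamentalLatticeRep 2).N) ℂ := fun ν => (fundamentalLatticeRep 2).lieProj (noiseDir ν) with hP
  set reb : (Edge 3 L × Fin (fundamentalLatticeRep 2).N × Fin (fundamentalLatticeRep 2).N × Bool → ℝ) → (Edge 3 L → Matrix (Fin (fundamentalLatticeRep 2).N) (Fin (fundamentalLatticeRep 2).N) ℂ) := fun z => (fun (ee : Edge 3 L) => Matrix.of fun (i j : Fin (fundamentalLatticeRep 2).N) => ((z (ee, i, j, false) : ℝ) : ℂ) + ((z (ee, i, j, true) : ℝ) : ℂ) * Complex.I) with hreb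
  set σ : (Edge 3 L × NoiseIdx (fundamentalLatticeRep 2).N) → (Edge 3 L × Fin (fundamentalLatticeRep 2).N × Fin (fundamentalLatticeRep 2).N × Bool → ℝ) → (Edge 3 L × Fin (fundamentalLatticeRep 2).N × Fin (fundamentalLatticeRep 2).N × Bool → ℝ) := fun n z => (fun q : Edge 3 L × Fin (fundamentalLatticeRep 2).N × Fin (fundamentalLatticeRep 2).N × Bool => if n.1 = q.1 then (fun z : ℂ => if q.2.2.2 then z.im else z.re) (((Real.sqrt 2 : ℂ) • ((fundamentalLatticeRep 2).lieProj (noiseDir n.2) * (fun (ee : Edge 3 L) => Matrix.of fun (i j : Fin (fundamentalLatticeRep 2).N) => ((z (ee, i, j, false) : ℝ) : ℂ) + ((z (ee, i, j, true) : ℝ) : ℂ) * Complex.I) q.1)) q.2.1 q.2.2.1) else 0) with hσ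
  have hsσ : ∀ k z, s k z = σ k z := fun k z => hs k z
  have r_σ : ∀ k z, reb (σ k z) = fun e => if k.1 = e then (Real.sqrt 2 : ℂ) • (P k.2 * reb z e) else 0 :=
    fun k z => rebuild_noise k z
  rw [hsσ n y, hsσ m]
  have hzero : reb (σ n y) m.1 = 0 := by
    rw [r_σ n y]
    simp only [if_neg hne]
  funext q
  show (if m.1 = q.1 then (fun z : ℂ => if q.2.2.2 then z.im else z.re) (((Real.sqrt 2 : ℂ) • (P m.2 * reb (σ n y) q.1)) q.2.1 q.2.2.1) else 0) = 0
  by_cases h : m.1 = q.1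
  · rw [if_pos h, ← h, hzero, Matrix.mul_zero, smul_zero, Matrix.zero_apply]
    split_ifs <;> simp
  · rw [if_neg h]

omit [NeZero L] in
/-- **Every link weight is compatible with the noise frame**: `(c_(n.1) − c_(m.1)) • (σ_m(σ_n y) − σ_n(σ_m y)) = 0` — on one link
the weights agree, across links both compositions vanish (hypothesis `hw` of `…WeightedFrameBochner`). [folklore] -/
theorem weight_smul_noiseField_bracket_eq_zero
    (s : (Edge 3 L × NoiseIdx (fundamentalLatticeRep 2).N) → ((Edge 3 L × Fin (fundamentalLatticeRep 2).N × Fin (fundamentalLatticeRep 2).N × Bool → ℝ) →L[ℝ] (Edge 3 L × Fin (fundamentalLatticeRep 2).N × Fin (fundamentalLatticeRep 2).N × Bool → ℝ)))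
    (hs : ∀ (n : Edge 3 L × NoiseIdx (fundamentalLatticeRep 2).N) (y : Edge 3 L × Fin (fundamentalLatticeRep 2).N × Fin (fundamentalLatticeRep 2).N × Bool → ℝ), s n y = (fun q : Edge 3 L × Fin (fundamentalLatticeRep 2).N × Fin (fundamentalLatticeRep 2).N × Bool => if n.1 = q.1 then (fun z : ℂ => if q.2.2.2 then z.im else z.re) (((Real.sqrt 2 : ℂ) • ((fundamentalLatticeRep 2).lieProj (noiseDir n.2) * (fun (ee : Edge 3 L) => Matrix.of fun (i j : Fin (fundamentalLatticeRep 2).N) => ((y (ee, i, j, false) : ℝ) : ℂ) + ((y (ee, i, j, true) : ℝ) : ℂ) * Complex.I) q.1)) q.2.1 q.2.2.1) else 0))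
    (c : Edge 3 L → ℝ) (n m : Edge 3 L × NoiseIdx (fundamentalLatticeRep 2).N) (y : Edge 3 L × Fin (fundamentalLatticeRep 2).N × Fin (fundamentalLatticeRep 2).N × Bool → ℝ) :
    (c n.1 - c m.1) • (s m (s n y) - s n (s m y)) = 0 := by
  by_cases h : n.1 = m.1
  · rw [h, sub_self, zero_smul]
  · rw [noiseField_comp_eq_zero_of_ne s hs n m h y, noiseField_comp_eq_zero_of_ne s hs m n (Ne.symm h) y, sub_zero, smul_zero]

/-! ## §2. The weighted Ricci identity -/

/-- ★ **Weighted Ricci identity of the noise frame**: for every link weight `c`, every continuous linear functional `Λ` and every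
point `y`, `¼ Σ_(n,m) c_(m.1) Λ(σ_m(σ_n y) − σ_n(σ_m y))² = 2 Σ_n c_(n.1) Λ(σ_n y)²` (any linear realisation `s` of the noise fields) —
the Ricci identity of `exists_noiseFrame` applied to `Λ ∘ π_e` for the coordinate projection `π_e` of each link and summed with the
weights (brackets of fields on one link live on that link, brackets across links vanish). [folklore] -/
theorem weighted_ricci_identity
    (s : (Edge 3 L × NoiseIdx (fundamentalLatticeRep 2).N) → ((Edge 3 L × Fin (fundamentalLatticeRep 2).N × Fin (fundamentalLatticeRep 2).N × Bool → ℝ) →L[ℝ] (Edge 3 L × Fin (fundamentalLatticeRep 2).N × Fin (fundamentalLatticeRep 2).N × Bool → ℝ)))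
    (hs : ∀ (n : Edge 3 L × NoiseIdx (fundamentalLatticeRep 2).N) (y : Edge 3 L × Fin (fundamentalLatticeRep 2).N × Fin (fundamentalLatticeRep 2).N × Bool → ℝ), s n y = (fun q : Edge 3 L × Fin (fundamentalLatticeRep 2).N × Fin (fundamentalLatticeRep 2).N × Bool => if n.1 = q.1 then (fun z : ℂ => if q.2.2.2 then z.im else z.re) (((Real.sqrt 2 : ℂ) • ((fundamentalLatticeRep 2).lieProj (noiseDir n.2) * (fun (ee : Edge 3 L) => Matrix.of fun (i j : Fin (fundamentalLatticeRep 2).N) => ((y (ee, i, j, false) : ℝ) : ℂ) + ((y (ee, i, j, true) : ℝ) : ℂ) * Complex.I) q.1)) q.2.1 q.2.2.1) else 0))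
    (c : Edge 3 L → ℝ) (Λ : (Edge 3 L × Fin (fundamentalLatticeRep 2).N × Fin (fundamentalLatticeRep 2).N × Bool → ℝ) →L[ℝ] ℝ) (y : Edge 3 L × Fin (fundamentalLatticeRep 2).N × Fin (fundamentalLatticeRep 2).N × Bool → ℝ) :
    (1 / 4 : ℝ) * ∑ n : Edge 3 L × NoiseIdx (fundamentalLatticeRep 2).N, ∑ m : Edge 3 L × NoiseIdx (fundamentalLatticeRep 2).N, c m.1 * (Λ (s m (s n y) - s n (s m y))) ^ 2 =
      2 * ∑ n : Edge 3 L × NoiseIdx (fundamentalLatticeRep 2).N, c n.1 * (Λ (s n y)) ^ 2 := by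
  classical
  obtain ⟨s', cc, hs', -, -, hRic, -⟩ := exists_noiseFrame L
  have hss : ∀ n, s' n = s n := fun n => ContinuousLinearMap.ext fun z => by rw [hs', hs]
  simp only [hss] at hRic
  have hcross : ∀ n m z, n.1 ≠ m.1 → s m (s n z) = 0 := fun n m z hne => noiseField_comp_eq_zero_of_ne s hs n m hne z
  -- support of a field: `σ_n z` vanishes off the link `n.1`
  have hsupp : ∀ n z q, n.1 ≠ q.1 → s n z q = 0 := by
    intro n z q hq
    rw [hs n z]
    show (if n.1 = q.1 then (fun z : ℂ => if q.2.2.2 then z.im else z.re) (((Real.sqrt 2 : ℂ) • ((fundamentalLatticeRep 2).lieProj (noiseDir n.2) * (fun (ee : Edge 3 L) => Matrix.of fun (i j : Fin (fundamentalLatticeRep 2).N) => ((z (ee, i, j, false) : ℝ) : ℂ) + ((z (ee, i, j, true) : ℝ) : ℂ) * Complex.I) q.1)) q.2.1 q.2.2.1) else 0) = 0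
    rw [if_neg hq]
  -- the coordinate projection of a link as a continuous linear map
  have hproj : ∀ e : Edge 3 L, ∃ π : (Edge 3 L × Fin (fundamentalLatticeRep 2).N × Fin (fundamentalLatticeRep 2).N × Bool → ℝ) →L[ℝ] (Edge 3 L × Fin (fundamentalLatticeRep 2).N × Fin (fundamentalLatticeRep 2).N × Bool → ℝ), ∀ z q, π z q = if q.1 = e then z q else 0 := by
    intro e
    let πl : (Edge 3 L × Fin (fundamentalLatticeRep 2).N × Fin (fundamentalLatticeRep 2).N × Bool → ℝ) →ₗ[ℝ] (Edge 3 L × Fin (fundamentalLatticeRep 2).N × Fin (fundamentalLatticeRep 2).N × Bool → ℝ) :=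
      { toFun := fun z q => if q.1 = e then z q else 0
        map_add' := fun z z' => by funext q; simp only [Pi.add_apply]; split_ifs <;> ring
        map_smul' := fun a z => by funext q; simp only [Pi.smul_apply, smul_eq_mul, RingHom.id_apply]; split_ifs <;> ring }
    exact ⟨LinearMap.toContinuousLinearMap πl, fun z q => rfl⟩
  choose π hπ using hproj
  -- `π_e (σ_n z) = [n.1 = e] σ_n z`
  have hπσ : ∀ e n z, π e (s n z) = if n.1 = e then s n z else 0 := by
    intro e n z
    funext q
    rw [hπ]
    by_cases h1 : n.1 = e
    · rw [if_pos h1]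
      by_cases h2 : q.1 = e
      · rw [if_pos h2]
      · rw [if_neg h2, hsupp n z q (by rw [h1]; exact Ne.symm h2)]
    · rw [if_neg h1, Pi.zero_apply]
      by_cases h2 : q.1 = e
      · rw [if_pos h2, hsupp n z q (by rw [h2]; exact h1)]
      · rw [if_neg h2]
  -- `π_e` of a bracket: `[m.1 = e] · bracket`
  have hπbr : ∀ e n m, π e (s m (s n y) - s n (s m y)) = if m.1 = e then (s m (s n y) - s n (s m y)) else 0 := by
    intro e n m
    rw [map_sub, hπσ, hπσ]
    by_cases hm : m.1 = e
    · rw [if_pos hm, if_pos hm]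
      by_cases hn : n.1 = e
      · rw [if_pos hn]
      · rw [if_neg hn, hcross m n y (by rw [hm]; exact Ne.symm hn), sub_zero]
    · rw [if_neg hm, if_neg hm, zero_sub, neg_eq_zero]
      by_cases hn : n.1 = e
      · rw [if_pos hn, hcross m n y (by rw [hn]; exact hm)]
      · rw [if_neg hn]
  -- Ricci identity for `Λ ∘ π_e`, link by link
  have hRe : ∀ e : Edge 3 L, (1 / 4 : ℝ) * ∑ n, ∑ m, (if m.1 = e then (Λ (s m (s n y) - s n (s m y))) ^ 2 else 0) =
      2 * ∑ n, (if n.1 = e then (Λ (s n y)) ^ 2 else 0) := by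
    intro e
    have h := hRic (Λ.comp (π e)) y
    simp only [ContinuousLinearMap.comp_apply] at h
    have hl : ∀ n m, (Λ (π e (s m (s n y) - s n (s m y)))) ^ 2 = if m.1 = e then (Λ (s m (s n y) - s n (s m y))) ^ 2 else 0 := by
      intro n m; rw [hπbr]
      by_cases h : m.1 = e
      · rw [if_pos h, if_pos h]
      · rw [if_neg h, if_neg h, map_zero]; ring
    have hr : ∀ n, (Λ (π e (s n y))) ^ 2 = if n.1 = e then (Λ (s n y)) ^ 2 else 0 := by
      intro n; rw [hπσ]
      by_cases h : n.1 = e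
      · rw [if_pos h, if_pos h]
      · rw [if_neg h, if_neg h, map_zero]; ring
    simp only [hl, hr] at h
    exact h
  -- multiply by `c e` and sum over the links
  have hsum : ∑ e, c e * ((1 / 4 : ℝ) * ∑ n, ∑ m, (if m.1 = e then (Λ (s m (s n y) - s n (s m y))) ^ 2 else 0)) =
      ∑ e, c e * (2 * ∑ n, (if n.1 = e then (Λ (s n y)) ^ 2 else 0)) := Finset.sum_congr rfl fun e _ => by rw [hRe e]
  have hL : ∑ e, c e * ((1 / 4 : ℝ) * ∑ n, ∑ m, (if m.1 = e then (Λ (s m (s n y) - s n (s m y))) ^ 2 else 0)) =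
      (1 / 4 : ℝ) * ∑ n, ∑ m, c m.1 * (Λ (s m (s n y) - s n (s m y))) ^ 2 := by
    have e1 : ∀ e, c e * ((1 / 4 : ℝ) * ∑ n, ∑ m, (if m.1 = e then (Λ (s m (s n y) - s n (s m y))) ^ 2 else 0)) =
        (1 / 4 : ℝ) * ∑ n, ∑ m, (if m.1 = e then c e * (Λ (s m (s n y) - s n (s m y))) ^ 2 else 0) := by
      intro e
      rw [mul_left_comm, Finset.mul_sum]
      congr 1
      refine Finset.sum_congr rfl fun n _ => ?_
      rw [Finset.mul_sum]
      refine Finset.sum_congr rfl fun m _ => ?_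
      split_ifs <;> simp
    simp_rw [e1]
    rw [← Finset.mul_sum, Finset.sum_comm]
    congr 1
    refine Finset.sum_congr rfl fun n _ => ?_
    rw [Finset.sum_comm]
    refine Finset.sum_congr rfl fun m _ => ?_
    rw [Finset.sum_ite_eq Finset.univ m.1, if_pos (Finset.mem_univ _)]
  have hR : ∑ e, c e * (2 * ∑ n, (if n.1 = e then (Λ (s n y)) ^ 2 else 0)) = 2 * ∑ n, c n.1 * (Λ (s n y)) ^ 2 := by
    have e1 : ∀ e, c e * (2 * ∑ n, (if n.1 = e then (Λ (s n y)) ^ 2 else 0)) =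
        2 * ∑ n, (if n.1 = e then c e * (Λ (s n y)) ^ 2 else 0) := by
      intro e
      rw [mul_left_comm, Finset.mul_sum, Finset.mul_sum, Finset.mul_sum]
      refine Finset.sum_congr rfl fun n _ => ?_
      split_ifs <;> simp [mul_left_comm]
    simp_rw [e1]
    rw [← Finset.mul_sum, Finset.sum_comm]
    congr 1
    refine Finset.sum_congr rfl fun n _ => ?_
    rw [Finset.sum_ite_eq Finset.univ n.1, if_pos (Finset.mem_univ _)]
  rw [hL, hR] at hsum
  exact hsum

/-! ## §3. The pointwise weighted curvature inequality on the group -/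

/-- ★★ **Pointwise WEIGHTED `CD(1 − K₀/2, ∞)` for the SZZ generator on `SU(2)^E`.**  Let `c ≥ 0` be a link weight.  If the frame
Hessian of the plaquette function obeys the weighted bound `hHess` with constant `K₀`, then for every `C³` function `u` of the real link
coordinates and every `C²` function `v` representing `𝓛u` on the group (`v∘coords = 𝓛u`), at EVERY configuration `V`:
`(2 − K₀)·Σ_n c_(n.1)(W_nu)²(V) ≤ 𝓛(Σ_n c_(n.1)(W_nu)²)(V) − 2·Σ_n c_(n.1) W_nu(V)·W_nv(V)`
— the weighted `Γ₂ ≥ ρΓ^c`, `ρ = 1 − K₀/2`, written with the tree's coordinate generator.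
[cite: BakryGentilLedoux2014, (1.16.3), (C.5.3) and Prop. 3.3.18; ShenZhuZhu2022 §5 Lemma 5.1 / (5.13)] -/
theorem generator_wcarre_sub_ge_of_whessBound (L : ℕ) [NeZero L] (β' K₀ : ℝ) (c : Edge 3 L → ℝ) (hc0 : ∀ e, 0 ≤ c e)
    (hHess : (∀ (V : (GaugeConfig 3 L (Matrix.specialUnitaryGroup (Fin 2) ℂ))) (Λ : (Edge 3 L × Fin (fundamentalLatticeRep 2).N × Fin (fundamentalLatticeRep 2).N × Bool → ℝ) →L[ℝ] ℝ),
      ∑ n : Edge 3 L × NoiseIdx (fundamentalLatticeRep 2).N, ∑ m : Edge 3 L × NoiseIdx (fundamentalLatticeRep 2).N,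
        c n.1 * Λ ((fun q : Edge 3 L × Fin (fundamentalLatticeRep 2).N × Fin (fundamentalLatticeRep 2).N × Bool => if n.1 = q.1 then (fun z : ℂ => if q.2.2.2 then z.im else z.re) (((Real.sqrt 2 : ℂ) • ((fundamentalLatticeRep 2).lieProj (noiseDir n.2) * (fun (ee : Edge 3 L) => Matrix.of fun (i j : Fin (fundamentalLatticeRep 2).N) => (((fun (V : GaugeConfig 3 L (Matrix.specialUnitaryGroup (Fin 2) ℂ)) (q : Edge 3 L × Fin (fundamentalLatticeRep 2).N × Fin (fundamentalLatticeRep 2).N × Bool) => (fun z : ℂ => if q.2.2.2 then z.im else z.re) ((fundamentalRep (Fin 2) (V q.1) : Matrix (Fin 2) (Fin 2) ℂ) q.2.1 q.2.2.1)) V (ee, i, j, false) : ℝ) : ℂ) + (((fun (V : GaugeConfig 3 L (Matrix.specialUnitaryGroup (Fin 2) ℂ)) (q : Edge 3 L × Fin (fundamentalLatticeRep 2).N × Fin (fundamentalLatticeRep 2).N × Bool) => (fun z : ℂ => if q.2.2.2 then z.im else z.re) ((fundamentalRep (Fin 2) (V q.1) : Matrix (Fin 2) (Fin 2) ℂ)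 q.2.1 q.2.2.1)) V (ee, i, j, true) : ℝ) : ℂ) * Complex.I) q.1)) q.2.1 q.2.2.1) else 0)) * Λ ((fun q : Edge 3 L × Fin (fundamentalLatticeRep 2).N × Fin (fundamentalLatticeRep 2).N × Bool => if m.1 = q.1 then (fun z : ℂ => if q.2.2.2 then z.im else z.re) (((Real.sqrt 2 : ℂ) • ((fundamentalLatticeRep 2).lieProj (noiseDir m.2) * (fun (ee : Edge 3 L) => Matrix.of fun (i j : Fin (fundamentalLatticeRep 2).N) => (((fun (V : GaugeConfig 3 L (Matrix.specialUnitaryGroup (Fin 2) ℂ)) (q : Edge 3 L × Fin (fundamentalLatticeRep 2).N × Fin (fundamentalLatticeRep 2).N × Bool) => (fun z : ℂ => if q.2.2.2 then z.im else z.re) ((fundamentalRep (Fin 2) (V q.1) : Matrix (Fin 2) (Fin 2) ℂ) q.2.1 q.2.2.1)) V (ee, i, j, false) : ℝ) : ℂ) + (((fun (V : GaugeConfig 3 L (Matrix.specialUnitaryGroup (Fin 2) ℂ)) (q : Edge 3 L × Fin (fundamentalLatticeRep 2).N × Fin (fundamentalLatticeRep 2).N × Bool) => (fun z : ℂ =>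 if q.2.2.2 then z.im else z.re) ((fundamentalRep (Fin 2) (V q.1) : Matrix (Fin 2) (Fin 2) ℂ) q.2.1 q.2.2.1)) V (ee, i, j, true) : ℝ) : ℂ) * Complex.I) q.1)) q.2.1 q.2.2.1) else 0)) *
          fderiv ℝ (fun z : (Edge 3 L × Fin (fundamentalLatticeRep 2).N × Fin (fundamentalLatticeRep 2).N × Bool → ℝ) => fderiv ℝ (fun y : (Edge 3 L × Fin (fundamentalLatticeRep 2).N × Fin (fundamentalLatticeRep 2).N × Bool → ℝ) => β' * ∑ p : Plaquette 3 L, (rootedLoop (fun (ee : Edge 3 L) (i j : Fin (fundamentalLatticeRep 2).N) => ((y (ee, i, j, false) : ℝ) : ℂ) + ((y (ee, i, j, true) : ℝ) : ℂ) * Complex.I) (p.1, p.2.1.1) p.2.1.2 false).trace.re) z (fun q : Edge 3 L × Fin (fundamentalLatticeRep 2).N × Fin (fundamentalLatticeRep 2).N × Bool => if m.1 = q.1 then (fun z : ℂ => if q.2.2.2 then z.im else z.re) (((Real.sqrt 2 : ℂ) • ((fundamentalLatticeRep 2).lieProj (noiseDir m.2) * (fun (ee : Edge 3 L) => Matrix.of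 fun (i j : Fin (fundamentalLatticeRep 2).N) => ((z (ee, i, j, false) : ℝ) : ℂ) + ((z (ee, i, j, true) : ℝ) : ℂ) * Complex.I) q.1)) q.2.1 q.2.2.1) else 0)) ((fun (V : GaugeConfig 3 L (Matrix.specialUnitaryGroup (Fin 2) ℂ)) (q : Edge 3 L × Fin (fundamentalLatticeRep 2).N × Fin (fundamentalLatticeRep 2).N × Bool) => (fun z : ℂ => if q.2.2.2 then z.im else z.re) ((fundamentalRep (Fin 2) (V q.1) : Matrix (Fin 2) (Fin 2) ℂ) q.2.1 q.2.2.1)) V) (fun q : Edge 3 L × Fin (fundamentalLatticeRep 2).N × Fin (fundamentalLatticeRep 2).N × Bool => if n.1 = q.1 then (fun z : ℂ => if q.2.2.2 then z.im else z.re) (((Real.sqrt 2 : ℂ) • ((fundamentalLatticeRep 2).lieProj (noiseDir n.2) * (fun (ee : Edge 3 L) => Matrix.of fun (i j : Fin (fundamentalLatticeRep 2).N) => (((fun (V : GaugeConfig 3 L (Matrix.specialUnitaryGroup (Fin 2) ℂ)) (q : Edge 3 L × Fin (fundamentalLatticeRep 2).N × Fin (fundamentalLatticeRep 2).N × Bool)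 => (fun z : ℂ => if q.2.2.2 then z.im else z.re) ((fundamentalRep (Fin 2) (V q.1) : Matrix (Fin 2) (Fin 2) ℂ) q.2.1 q.2.2.1)) V (ee, i, j, false) : ℝ) : ℂ) + (((fun (V : GaugeConfig 3 L (Matrix.specialUnitaryGroup (Fin 2) ℂ)) (q : Edge 3 L × Fin (fundamentalLatticeRep 2).N × Fin (fundamentalLatticeRep 2).N × Bool) => (fun z : ℂ => if q.2.2.2 then z.im else z.re) ((fundamentalRep (Fin 2) (V q.1) : Matrix (Fin 2) (Fin 2) ℂ) q.2.1 q.2.2.1)) V (ee, i, j, true) : ℝ) : ℂ) * Complex.I) q.1)) q.2.1 q.2.2.1) else 0)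
        ≤ K₀ * ∑ n : Edge 3 L × NoiseIdx (fundamentalLatticeRep 2).N, c n.1 * (Λ (fun q : Edge 3 L × Fin (fundamentalLatticeRep 2).N × Fin (fundamentalLatticeRep 2).N × Bool => if n.1 = q.1 then (fun z : ℂ => if q.2.2.2 then z.im else z.re) (((Real.sqrt 2 : ℂ) • ((fundamentalLatticeRep 2).lieProj (noiseDir n.2) * (fun (ee : Edge 3 L) => Matrix.of fun (i j : Fin (fundamentalLatticeRep 2).N) => (((fun (V : GaugeConfig 3 L (Matrix.specialUnitaryGroup (Fin 2) ℂ)) (q : Edge 3 L × Fin (fundamentalLatticeRep 2).N × Fin (fundamentalLatticeRep 2).N × Bool) => (fun z : ℂ => if q.2.2.2 then z.im else z.re) ((fundamentalRep (Fin 2) (V q.1) : Matrix (Fin 2) (Fin 2) ℂ) q.2.1 q.2.2.1)) V (ee, i, j, false) : ℝ) : ℂ) + (((fun (V : GaugeConfig 3 L (Matrix.specialUnitaryGroup (Fin 2) ℂ)) (q : Edge 3 L × Fin (fundamentalLatticeRep 2).N × Fin (fundamentalLatticeRep 2).N × Bool) => (fun z : ℂ => if q.2.2.2 then z.im else z.re)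 ((fundamentalRep (Fin 2) (V q.1) : Matrix (Fin 2) (Fin 2) ℂ) q.2.1 q.2.2.1)) V (ee, i, j, true) : ℝ) : ℂ) * Complex.I) q.1)) q.2.1 q.2.2.1) else 0)) ^ 2))
    {u v : (Edge 3 L × Fin 2 × Fin 2 × Bool → ℝ) → ℝ} (hu : ContDiff ℝ 3 u) (hv : ContDiff ℝ 2 v) :
    let coords : GaugeConfig 3 L (Matrix.specialUnitaryGroup (Fin 2) ℂ) → (Edge 3 L × Fin 2 × Fin 2 × Bool → ℝ) :=
      fun V q => (fun z : ℂ => if q.2.2.2 then z.im else z.re)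
        ((fundamentalRep (Fin 2) (V q.1) : Matrix (Fin 2) (Fin 2) ℂ) q.2.1 q.2.2.1)
    let gen : ((Edge 3 L × Fin 2 × Fin 2 × Bool → ℝ) → ℝ) → GaugeConfig 3 L (Matrix.specialUnitaryGroup (Fin 2) ℂ) → ℝ :=
      fun h V =>
      (∑ i : Edge 3 L × Fin 2 × Fin 2 × Bool, fderiv ℝ h (coords V) (Pi.single i 1) *
          (fun z : ℂ => if i.2.2.2 then z.im else z.re)
            ((latticeLangevinDynamics (fundamentalLatticeRep 2) β').drift
              (matrixConfig (fundamentalRep (Fin 2)) V) i.1 i.2.1 i.2.2.1) +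
      1 / 2 * ∑ i : Edge 3 L × Fin 2 × Fin 2 × Bool, ∑ j : Edge 3 L × Fin 2 × Fin 2 × Bool,
        fderiv ℝ (fun z => fderiv ℝ h z (Pi.single i 1)) (coords V) (Pi.single j 1) *
          ∑ n : Edge 3 L × NoiseIdx 2,
            (if n.1 = i.1 then (fun z : ℂ => if i.2.2.2 then z.im else z.re)
              ((latticeLangevinDynamics (fundamentalLatticeRep 2) β').noise
                (matrixConfig (fundamentalRep (Fin 2)) V) i.1 n.2 i.2.1 i.2.2.1) else 0) *
            (if n.1 = j.1 then (fun z : ℂ => if j.2.2.2 then z.im else z.re)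
              ((latticeLangevinDynamics (fundamentalLatticeRep 2) β').noise
                (matrixConfig (fundamentalRep (Fin 2)) V) j.1 n.2 j.2.1 j.2.2.1) else 0))
    (∀ V, v (coords V) = gen u V) → ∀ V,
      (2 - K₀) * ∑ n : Edge 3 L × NoiseIdx (fundamentalLatticeRep 2).N, c n.1 * (fderiv ℝ u (coords V) (fun q : Edge 3 L × Fin (fundamentalLatticeRep 2).N × Fin (fundamentalLatticeRep 2).N × Bool => if n.1 = q.1 then (fun z : ℂ => if q.2.2.2 then z.im else z.re) (((Real.sqrt 2 : ℂ) • ((fundamentalLatticeRep 2).lieProj (noiseDir n.2) * (fun (ee : Edge 3 L) => Matrix.of fun (i j : Fin (fundamentalLatticeRep 2).N) => ((coords V (ee, i, j, false) : ℝ) : ℂ) + ((coords V (ee, i, j, true) : ℝ) : ℂ) * Complex.I) q.1)) q.2.1 q.2.2.1) else 0)) ^ 2 ≤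
        gen (fun y : (Edge 3 L × Fin 2 × Fin 2 × Bool → ℝ) => ∑ n : Edge 3 L × NoiseIdx (fundamentalLatticeRep 2).N, c n.1 * (fderiv ℝ u y (fun q : Edge 3 L × Fin (fundamentalLatticeRep 2).N × Fin (fundamentalLatticeRep 2).N × Bool => if n.1 = q.1 then (fun z : ℂ => if q.2.2.2 then z.im else z.re) (((Real.sqrt 2 : ℂ) • ((fundamentalLatticeRep 2).lieProj (noiseDir n.2) * (fun (ee : Edge 3 L) => Matrix.of fun (i j : Fin (fundamentalLatticeRep 2).N) => ((y (ee, i, j, false) : ℝ) : ℂ) + ((y (ee, i, j, true) : ℝ) : ℂ) * Complex.I) q.1)) q.2.1 q.2.2.1) else 0)) ^ 2) V -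
          2 * ∑ n : Edge 3 L × NoiseIdx (fundamentalLatticeRep 2).N, c n.1 * fderiv ℝ u (coords V) (fun q : Edge 3 L × Fin (fundamentalLatticeRep 2).N × Fin (fundamentalLatticeRep 2).N × Bool => if n.1 = q.1 then (fun z : ℂ => if q.2.2.2 then z.im else z.re) (((Real.sqrt 2 : ℂ) • ((fundamentalLatticeRep 2).lieProj (noiseDir n.2) * (fun (ee : Edge 3 L) => Matrix.of fun (i j : Fin (fundamentalLatticeRep 2).N) => ((coords V (ee, i, j, false) : ℝ) : ℂ) + ((coords V (ee, i, j, true) : ℝ) : ℂ) * Complex.I) q.1)) q.2.1 q.2.2.1) else 0) * fderiv ℝ v (coords V) (fun q : Edge 3 L × Fin (fundamentalLatticeRep 2).N × Fin (fundamentalLatticeRep 2).N × Bool => if n.1 = q.1 then (fun z : ℂ => if q.2.2.2 then z.im else z.re) (((Real.sqrt 2 : ℂ) • ((fundamentalLatticeRep 2).lieProj (noiseDir n.2) * (fun (ee : Edge 3 L) => Matrix.of fun (i j : Fin (fundamentalLatticeRep 2).N) => ((coords V (ee, i, j, false) : ℝ) : ℂ) + ((coords V (ee, i, j, true) : ℝ)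 : ℂ) * Complex.I) q.1)) q.2.1 q.2.2.1) else 0) := by
  intro coords gen huv V
  classical
  obtain ⟨s, cc, hs, hbr, hanti, hRic, hCas⟩ := exists_noiseFrame L
  set s2 : (Edge 3 L × NoiseIdx (fundamentalLatticeRep 2).N) → ((Edge 3 L × Fin 2 × Fin 2 × Bool → ℝ) →L[ℝ] (Edge 3 L × Fin 2 × Fin 2 × Bool → ℝ)) := s with hs2def
  set ψ : (Edge 3 L × Fin 2 × Fin 2 × Bool → ℝ) → ℝ := (fun y : (Edge 3 L × Fin (fundamentalLatticeRep 2).N × Fin (fundamentalLatticeRep 2).N × Bool → ℝ) => β' * ∑ p : Plaquette 3 L, (rootedLoop (fun (ee : Edge 3 L) (i j : Fin (fundamentalLatticeRep 2).N) => ((y (ee, i, j, false) : ℝ) : ℂ) + ((y (ee, i, j, true) : ℝ) : ℂ) * Complex.I) (p.1, p.2.1.1) p.2.1.2 false).trace.re) with hψ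
  have hψC : ContDiff ℝ 2 ψ := (contDiff_psiHat (d := 3) (L := L) (N := (fundamentalLatticeRep 2).N) β').of_le le_top
  have hu2 : ContDiff ℝ 2 u := hu.of_le (by norm_num)
  have hbr2 : ∀ (n m : Edge 3 L × NoiseIdx (fundamentalLatticeRep 2).N) (y : (Edge 3 L × Fin 2 × Fin 2 × Bool → ℝ)), s2 m (s2 n y) - s2 n (s2 m y) = ∑ k, cc n m k • s2 k y :=
    fun n m y => hbr n m y
  have hs2 : ∀ (n : Edge 3 L × NoiseIdx (fundamentalLatticeRep 2).N) (y : (Edge 3 L × Fin 2 × Fin 2 × Bool → ℝ)), s2 n y = (fun q : Edge 3 L × Fin (fundamentalLatticeRep 2).N × Fin (fundamentalLatticeRep 2).N × Bool => if n.1 = q.1 then (fun z : ℂ => if q.2.2.2 then z.im else z.re) (((Real.sqrt 2 : ℂ) • ((fundamentalLatticeRep 2).lieProj (noiseDir n.2) * (fun (ee : Edge 3 L) => Matrix.of fun (i j : Fin (fundamentalLatticeRep 2).N) => ((y (ee, i, j, false) : ℝ) : ℂ) + ((y (ee, i, j, true) : ℝ) : ℂ) * Complex.I) q.1)) q.2.1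 q.2.2.1) else 0) := fun n y => hs n y
  -- the link weight on frame indices and its compatibility with the frame
  have hw2 : ∀ (n m : Edge 3 L × NoiseIdx (fundamentalLatticeRep 2).N) (y : (Edge 3 L × Fin 2 × Fin 2 × Bool → ℝ)), (c n.1 - c m.1) • (s2 m (s2 n y) - s2 n (s2 m y)) = (0 : Edge 3 L × Fin 2 × Fin 2 × Bool → ℝ) :=
    fun n m y => weight_smul_noiseField_bracket_eq_zero (L := L) s hs c n m y
  have hw0 : ∀ n : Edge 3 L × NoiseIdx (fundamentalLatticeRep 2).N, 0 ≤ c n.1 := fun n => hc0 n.1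
  -- the ambient weighted frame carré `Gu = Σ_n c_(n.1) (W_n u)²` and its regularity
  set Gu : (Edge 3 L × Fin 2 × Fin 2 × Bool → ℝ) → ℝ := fun z => ∑ n, c n.1 * (fderiv ℝ u z (s2 n z)) ^ 2 with hGu
  have hGu_eq : (fun y : (Edge 3 L × Fin 2 × Fin 2 × Bool → ℝ) => ∑ n : Edge 3 L × NoiseIdx (fundamentalLatticeRep 2).N, c n.1 * (fderiv ℝ u y (fun q : Edge 3 L × Fin (fundamentalLatticeRep 2).N × Fin (fundamentalLatticeRep 2).N × Bool => if n.1 = q.1 then (fun z : ℂ => if q.2.2.2 then z.im else z.re) (((Real.sqrt 2 : ℂ) • ((fundamentalLatticeRep 2).lieProj (noiseDir n.2) * (fun (ee : Edge 3 L) => Matrix.of fun (i j : Fin (fundamentalLatticeRep 2).N) => ((y (ee, i, j, false) : ℝ) : ℂ) + ((y (ee, i, j, true) : ℝ) : ℂ) * Complex.I) q.1)) q.2.1 q.2.2.1) else 0)) ^ 2) = Gu := by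
    funext z
    show (∑ n : Edge 3 L × NoiseIdx (fundamentalLatticeRep 2).N, c n.1 * (fderiv ℝ u z (fun q : Edge 3 L × Fin (fundamentalLatticeRep 2).N × Fin (fundamentalLatticeRep 2).N × Bool => if n.1 = q.1 then (fun z : ℂ => if q.2.2.2 then z.im else z.re) (((Real.sqrt 2 : ℂ) • ((fundamentalLatticeRep 2).lieProj (noiseDir n.2) * (fun (ee : Edge 3 L) => Matrix.of fun (i j : Fin (fundamentalLatticeRep 2).N) => ((z (ee, i, j, false) : ℝ) : ℂ) + ((z (ee, i, j, true) : ℝ) : ℂ) * Complex.I) q.1)) q.2.1 q.2.2.1) else 0)) ^ 2) = ∑ n, c n.1 * (fderiv ℝ u z (s2 n z)) ^ 2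
    refine Finset.sum_congr rfl fun n _ => ?_
    rw [hs2 n z]
  have hGuC : ContDiff ℝ 2 Gu := ContDiff.sum fun n _ => contDiff_const.mul ((contDiff_frameDeriv (k := 2) hu (s2 n)).pow 2)
  -- the generator in frame form
  have hD : ∀ φ : (Edge 3 L × Fin 2 × Fin 2 × Bool → ℝ) → ℝ, ContDiff ℝ 2 φ → ∀ V : (GaugeConfig 3 L (Matrix.specialUnitaryGroup (Fin 2) ℂ)), gen φ V = 1 / 2 * ∑ n : Edge 3 L × NoiseIdx (fundamentalLatticeRep 2).N,
      (fderiv ℝ (fun w => fderiv ℝ φ w (s2 n w)) (coords V) (s2 n (coords V)) +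
        fderiv ℝ ψ (coords V) (s2 n (coords V)) * fderiv ℝ φ (coords V) (s2 n (coords V))) :=
    fun φ hφ V => generator_eq_half_frameGen L β' s hs hCas φ hφ V
  -- the frame generator of `u` (ambient, `C¹`) and `2v` agree on the group, hence so do their frame derivatives
  set Lu : (Edge 3 L × Fin 2 × Fin 2 × Bool → ℝ) → ℝ := fun z => ∑ m, (fderiv ℝ (fun w => fderiv ℝ u w (s2 m w)) z (s2 m z) +
      fderiv ℝ ψ z (s2 m z) * fderiv ℝ u z (s2 m z)) with hLu
  have hLuC : ContDiff ℝ 1 Lu := contDiff_frameGen (k := 1) hu hψC s2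
  have hLu_group : ∀ V' : (GaugeConfig 3 L (Matrix.specialUnitaryGroup (Fin 2) ℂ)), Lu (coords V') = (fun z => 2 * v z) (coords V') := by
    intro V'
    show Lu (coords V') = 2 * v (coords V')
    rw [huv V', hD u hu2 V', hLu]
    ring
  have hWLu : ∀ n : Edge 3 L × NoiseIdx (fundamentalLatticeRep 2).N, fderiv ℝ Lu (coords V) (s2 n (coords V)) = 2 * fderiv ℝ v (coords V) (s2 n (coords V)) := by
    intro n
    have h2v : Differentiable ℝ (fun z : (Edge 3 L × Fin 2 × Fin 2 × Bool → ℝ) => 2 * v z) := (hv.differentiable (by norm_num)).const_mul 2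
    have h : fderiv ℝ Lu (coords V) (fun q : Edge 3 L × Fin (fundamentalLatticeRep 2).N × Fin (fundamentalLatticeRep 2).N × Bool => if n.1 = q.1 then (fun z : ℂ => if q.2.2.2 then z.im else z.re) (((Real.sqrt 2 : ℂ) • ((fundamentalLatticeRep 2).lieProj (noiseDir n.2) * (fun (ee : Edge 3 L) => Matrix.of fun (i j : Fin (fundamentalLatticeRep 2).N) => ((coords V (ee, i, j, false) : ℝ) : ℂ) + ((coords V (ee, i, j, true) : ℝ) : ℂ) * Complex.I) q.1)) q.2.1 q.2.2.1) else 0) = fderiv ℝ (fun z : (Edge 3 L × Fin 2 × Fin 2 × Bool → ℝ) => 2 * v z) (coords V) (fun q : Edge 3 L × Fin (fundamentalLatticeRep 2).N × Fin (fundamentalLatticeRep 2).N × Bool => if n.1 = q.1 then (fun z : ℂ => if q.2.2.2 then z.im else z.re) (((Real.sqrt 2 : ℂ) • ((fundamentalLatticeRep 2).lieProj (noiseDir n.2) * (fun (ee : Edge 3 L) => Matrix.of fun (i j : Fin (fundamentalLatticeRep 2).N) => ((coords V (ee, i, j, false) : ℝ) : ℂ) + ((coords V (ee, i, j, true) : ℝ)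 : ℂ) * Complex.I) q.1)) q.2.1 q.2.2.1) else 0) :=
      frameDeriv_eq_of_comp_coords_eq (L := L) n (hLuC.differentiable (by norm_num)) h2v hLu_group V
    rw [hs2 n (coords V), h, fderiv_const_mul ((hv.differentiable (by norm_num)) _) (2 : ℝ), _root_.smul_apply, smul_eq_mul]
  -- weighted Bochner, pointwise
  have hB := frameGammaTwo_pointwise_weighted hu hψC s2 cc hbr2 hanti (fun n => c n.1) hw2 (coords V)
  -- curvature: weighted Ricci part `2Γ^c`, weighted Hessian part `≥ −K₀Γ^c`
  have hpt : (2 - K₀) * ∑ n, c n.1 * (fderiv ℝ u (coords V) (s2 n (coords V))) ^ 2 ≤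
      ∑ n, ∑ m, c n.1 * (fderiv ℝ (fun z => fderiv ℝ u z (s2 n z)) (coords V) (s2 m (coords V))) ^ 2 -
        ∑ n, ∑ m, c n.1 * fderiv ℝ u (coords V) (s2 n (coords V)) * fderiv ℝ u (coords V) (s2 m (coords V)) * fderiv ℝ (fun z => fderiv ℝ ψ z (s2 m z)) (coords V) (s2 n (coords V)) := by
    have hq := quarter_sum_sum_wsq_bracket_le hu2 s2 (fun n => c n.1) hw0 hw2 (coords V)
    have hr : (1 / 4 : ℝ) * ∑ n, ∑ m, c m.1 * (fderiv ℝ u (coords V) (s2 m (s2 n (coords V)) - s2 n (s2 m (coords V)))) ^ 2 =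
        2 * ∑ n, c n.1 * (fderiv ℝ u (coords V) (s2 n (coords V))) ^ 2 := by
      exact weighted_ricci_identity (L := L) s hs c (fderiv ℝ u (coords V)) (coords V)
    have hH : ∑ n, ∑ m, c n.1 * fderiv ℝ u (coords V) (s2 n (coords V)) * fderiv ℝ u (coords V) (s2 m (coords V)) * fderiv ℝ (fun z => fderiv ℝ ψ z (s2 m z)) (coords V) (s2 n (coords V)) ≤
        K₀ * ∑ n, c n.1 * (fderiv ℝ u (coords V) (s2 n (coords V))) ^ 2 := by
      have h := hHess V (fderiv ℝ u (coords V))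
      have hsV : ∀ k : Edge 3 L × NoiseIdx (fundamentalLatticeRep 2).N, s2 k (coords V) = (fun q : Edge 3 L × Fin (fundamentalLatticeRep 2).N × Fin (fundamentalLatticeRep 2).N × Bool => if k.1 = q.1 then (fun z : ℂ => if q.2.2.2 then z.im else z.re) (((Real.sqrt 2 : ℂ) • ((fundamentalLatticeRep 2).lieProj (noiseDir k.2) * (fun (ee : Edge 3 L) => Matrix.of fun (i j : Fin (fundamentalLatticeRep 2).N) => ((coords V (ee, i, j, false) : ℝ) : ℂ) + ((coords V (ee, i, j, true) : ℝ) : ℂ) * Complex.I) q.1)) q.2.1 q.2.2.1) else 0) := fun k => hs2 k (coords V)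
      have hsz : ∀ k : Edge 3 L × NoiseIdx (fundamentalLatticeRep 2).N, (fun z : (Edge 3 L × Fin 2 × Fin 2 × Bool → ℝ) => fderiv ℝ ψ z (s2 k z)) =
          fun z : (Edge 3 L × Fin 2 × Fin 2 × Bool → ℝ) => fderiv ℝ ψ z (fun q : Edge 3 L × Fin (fundamentalLatticeRep 2).N × Fin (fundamentalLatticeRep 2).N × Bool => if k.1 = q.1 then (fun z : ℂ => if q.2.2.2 then z.im else z.re) (((Real.sqrt 2 : ℂ) • ((fundamentalLatticeRep 2).lieProj (noiseDir k.2) * (fun (ee : Edge 3 L) => Matrix.of fun (i j : Fin (fundamentalLatticeRep 2).N) => ((z (ee, i, j, false) : ℝ) : ℂ) + ((z (ee, i, j, true) : ℝ) : ℂ) * Complex.I) q.1)) q.2.1 q.2.2.1) else 0) := fun k => funext fun z => congrArg (fderiv ℝ ψ z) (hs2 k z)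
      simp_rw [hsz, hsV]
      exact h
    linarith [hq, hr, hH]
  -- dictionary for the statement's sums
  have hΓw : ∑ n : Edge 3 L × NoiseIdx (fundamentalLatticeRep 2).N, c n.1 * (fderiv ℝ u (coords V) (fun q : Edge 3 L × Fin (fundamentalLatticeRep 2).N × Fin (fundamentalLatticeRep 2).N × Bool => if n.1 = q.1 then (fun z : ℂ => if q.2.2.2 then z.im else z.re) (((Real.sqrt 2 : ℂ) • ((fundamentalLatticeRep 2).lieProj (noiseDir n.2) * (fun (ee : Edge 3 L) => Matrix.of fun (i j : Fin (fundamentalLatticeRep 2).N) => ((coords V (ee, i, j, false) : ℝ) : ℂ) + ((coords V (ee, i, j, true) : ℝ) : ℂ) * Complex.I) q.1)) q.2.1 q.2.2.1) else 0)) ^ 2 = ∑ n, c n.1 * (fderiv ℝ u (coords V) (s2 n (coords V))) ^ 2 := by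
    refine Finset.sum_congr rfl fun n _ => ?_
    rw [← hs2 n (coords V)]
  have hΓwv : ∑ n : Edge 3 L × NoiseIdx (fundamentalLatticeRep 2).N, c n.1 * fderiv ℝ u (coords V) (fun q : Edge 3 L × Fin (fundamentalLatticeRep 2).N × Fin (fundamentalLatticeRep 2).N × Bool => if n.1 = q.1 then (fun z : ℂ => if q.2.2.2 then z.im else z.re) (((Real.sqrt 2 : ℂ) • ((fundamentalLatticeRep 2).lieProj (noiseDir n.2) * (fun (ee : Edge 3 L) => Matrix.of fun (i j : Fin (fundamentalLatticeRep 2).N) => ((coords V (ee, i, j, false) : ℝ) : ℂ) + ((coords V (ee, i, j, true) : ℝ) : ℂ) * Complex.I) q.1)) q.2.1 q.2.2.1) else 0) * fderiv ℝ v (coords V) (fun q : Edge 3 L × Fin (fundamentalLatticeRep 2).N × Fin (fundamentalLatticeRep 2).N × Bool => if n.1 = q.1 then (fun z : ℂ => if q.2.2.2 then z.im else z.re) (((Real.sqrt 2 : ℂ) • ((fundamentalLatticeRep 2).lieProj (noiseDir n.2) * (fun (ee : Edge 3 L) => Matrix.of fun (i j : Fin (fundamentalLatticeRep 2).N) =>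 ((coords V (ee, i, j, false) : ℝ) : ℂ) + ((coords V (ee, i, j, true) : ℝ) : ℂ) * Complex.I) q.1)) q.2.1 q.2.2.1) else 0) = ∑ n, c n.1 * fderiv ℝ u (coords V) (s2 n (coords V)) * fderiv ℝ v (coords V) (s2 n (coords V)) := by
    refine Finset.sum_congr rfl fun n _ => ?_
    rw [← hs2 n (coords V)]
  -- assemble
  rw [hGu_eq, hΓw, hΓwv, hD Gu hGuC V]
  have hcross : ∑ n, c n.1 * fderiv ℝ u (coords V) (s2 n (coords V)) * fderiv ℝ Lu (coords V) (s2 n (coords V)) = 2 * ∑ n, c n.1 * fderiv ℝ u (coords V) (s2 n (coords V)) * fderiv ℝ v (coords V) (s2 n (coords V)) := by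
    rw [Finset.mul_sum]
    refine Finset.sum_congr rfl fun n _ => ?_
    rw [hWLu n]; ring
  have hB' : 1 / 2 * ∑ n, (fderiv ℝ (fun z => fderiv ℝ Gu z (s2 n z)) (coords V) (s2 n (coords V)) + fderiv ℝ ψ (coords V) (s2 n (coords V)) * fderiv ℝ Gu (coords V) (s2 n (coords V))) -
      ∑ n, c n.1 * fderiv ℝ u (coords V) (s2 n (coords V)) * fderiv ℝ Lu (coords V) (s2 n (coords V)) =
      ∑ n, ∑ m, c n.1 * (fderiv ℝ (fun z => fderiv ℝ u z (s2 n z)) (coords V) (s2 m (coords V))) ^ 2 -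
        ∑ n, ∑ m, c n.1 * fderiv ℝ u (coords V) (s2 n (coords V)) * fderiv ℝ u (coords V) (s2 m (coords V)) * fderiv ℝ (fun z => fderiv ℝ ψ z (s2 m z)) (coords V) (s2 n (coords V)) := hB
  rw [hcross] at hB'
  linarith [hpt, hB']

end Summit.QuantumFields.YangMills.Theorems.ColdStartUniversality
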